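import Mathlib

/-!
# SigmaW1RowSpec — the linear-algebra heart of the column-one row Σ-W1 and the closed arithmetic of its ×2 digits
(hsemireg-c4-1 g6, memo `C4-U2X2-SIGMAW1-c4-1-g6.md` §0 ∕ §6; companion of g5's `SigmaRowSpec.lean` for the column-zero rows Σ-H ∕ Σ-K)

Evidence-only crux workfile on `stmt-HodgeConjecture-18881` (D-0145 token: line stmt-HodgeConjecture-18881
Cruxes/BlochSeedDiscOne/Lines/birth.lean 814a6a70c14e831a stub_rung_pad4_seedAt (helper)).  An inequality of dimensions ≠ a sheaf ≠ semiregular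
≠ a SEED.  NOTHING here is proved toward HC ∕ HC_CM ∕ HC_AV ∕ №4 ∕ 26512 ∕ 18881 ∕ H2.

WHAT IS TYPED (kernel; `import Mathlib` only).  The LAST-COLUMN FLOOR of a first-quadrant-type bookkeeping: finite-dimensional spaces
`A →d B ←e C` ("E₁^{0,1} →d₁ E₁^{1,1} ← Z₂^{-1,2}, the lift of d₂") and a linear map `π : B → T` ("E₁^{1,1} ↠ E_∞^{1,1} = F¹ℍ² ↪ ℍ² = Ext²")
whose kernel is contained in `im d ⊔ im e`:

* `lastColumn_crude_floor`   : `dim B ≤ dim T + dim A + dim C`                       — crude Σ-W1: `ext² ≥ e₁^{1,1} − e₁^{0,1} − e₁^{−1,2}`;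
* `lastColumn_refined_floor` : for a surjection `p : B ↠ BJ` ("projection onto the J-blocks"),
                               `dim BJ ≤ dim T + rank (p ∘ d) + rank (p ∘ e)`          — refined Σ-W1: `ext² ≥ w¹(J) − dim p_J(im d₁) − dim p_J(im d₂)`;
* `lastColumn_refined_floor_of_comp_eq_zero` : the case `p ∘ e = 0` (memo §6: `p_J(im d₂) = 0` on S6′ because `U²(A_β → x) = U²(a_c → x) = 0`).

NOT typed (pen, memo §6; hypotheses (H2) φ injective, one declared atom stratum): that the hypercohomology spectral sequence of `Hom•(K,K)`,
`K = [𝓟 →φ 𝓝]`, has this shape (column +1 is the last column, so `E_∞^{1,1} = E₁^{1,1} ∕ (im d₁^{0,1} + im d₂^{−1,2})` and `E_∞^{1,1} = F¹ℍ² ≤ ℍ²`),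
the identification of `rank (p_J ∘ d₁)` with the adjacent V¹-mass `adjV¹`, and the block cohomology values themselves (machine: `code/u2x2_*.py`,
an independent second implementation of semihom-2 g4's row; both give the digits below).  Section `digits` re-checks the closed arithmetic of the
digits of record and of semihom-2's Σ-F floor on D_ε.
-/

set_option linter.dupNamespace false
set_option autoImplicit false

namespace Summit.HodgeConjecture.HodgeConjecture.Cruxes.BlochSeedDiscOne.SigmaW1Row

open Module

section floor
variable {K : Type*} [Field K] {A B C T BJ : Type*}
  [AddCommGroup A] [Module K A] [FiniteDimensional K A]
  [AddCommGroup B] [Module K B] [FiniteDimensional K B]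
  [AddCommGroup C] [Module K C] [FiniteDimensional K C]
  [AddCommGroup T] [Module K T] [FiniteDimensional K T]
  [AddCommGroup BJ] [Module K BJ] [FiniteDimensional K BJ]

/-- `dim (s ⊔ t) ≤ dim s + dim t`. -/
theorem finrank_sup_le (s t : Submodule K B) : finrank K ↥(s ⊔ t) ≤ finrank K s + finrank K t := by
  have h := Submodule.finrank_sup_add_finrank_inf_eq s t
  omega

omit [FiniteDimensional K T] in
/-- KERNEL BUDGET: if `ker π ≤ im d ⊔ im e` then `dim ker π ≤ rank d + rank e ≤ dim A + dim C`. -/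
theorem finrank_ker_le_of_le_sup (d : A →ₗ[K] B) (e : C →ₗ[K] B) (π : B →ₗ[K] T)
    (hker : LinearMap.ker π ≤ LinearMap.range d ⊔ LinearMap.range e) :
    finrank K (LinearMap.ker π) ≤ finrank K (LinearMap.range d) + finrank K (LinearMap.range e) :=
  (Submodule.finrank_mono hker).trans (finrank_sup_le _ _)

/-- CRUDE LAST-COLUMN FLOOR (crude Σ-W1): `dim B ≤ dim T + dim A + dim C` whenever `π : B → T` has `ker π ≤ im d ⊔ im e`. -/
theorem lastColumn_crude_floor (d : A →ₗ[K] B) (e : C →ₗ[K] B) (π : B →ₗ[K] T)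
    (hker : LinearMap.ker π ≤ LinearMap.range d ⊔ LinearMap.range e) :
    finrank K B ≤ finrank K T + finrank K A + finrank K C := by
  have h1 : finrank K (LinearMap.range π) + finrank K (LinearMap.ker π) = finrank K B :=
    LinearMap.finrank_range_add_finrank_ker π
  have h2 : finrank K (LinearMap.range π) ≤ finrank K T := Submodule.finrank_le _
  have h3 := finrank_ker_le_of_le_sup d e π hker
  have h4 : finrank K (LinearMap.range d) ≤ finrank K A := LinearMap.finrank_range_le d
  have h5 : finrank K (LinearMap.range e) ≤ finrank K C := LinearMap.finrank_range_le e
  omega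

omit [FiniteDimensional K BJ] in
/-- PROJECTION STEP: for a surjection `p : B ↠ BJ` and any subspace `N ≤ B`, `dim BJ ≤ dim (B ∕ N) + dim p(N)`, stated as
`dim BJ + dim N ≤ dim B + dim (map p N)`. -/
theorem finrank_add_finrank_le_of_surjective (p : B →ₗ[K] BJ) (hp : Function.Surjective p) (N : Submodule K B) :
    finrank K BJ + finrank K N ≤ finrank K B + finrank K (Submodule.map p N) := by
  -- rank–nullity for p and for p restricted to N
  have h1 : finrank K (LinearMap.range p) + finrank K (LinearMap.ker p) = finrank K B :=
    LinearMap.finrank_range_add_finrank_ker p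
  have h2 : finrank K (LinearMap.range p) = finrank K BJ := by
    rw [LinearMap.range_eq_top.mpr hp]; exact finrank_top K BJ
  set pN := p ∘ₗ N.subtype with hpN
  have h3 : finrank K (LinearMap.range pN) + finrank K (LinearMap.ker pN) = finrank K N :=
    LinearMap.finrank_range_add_finrank_ker pN
  have h4 : LinearMap.range pN = Submodule.map p N := by
    rw [hpN, LinearMap.range_comp, Submodule.range_subtype]
  -- ker pN embeds into ker p
  let j : LinearMap.ker pN →ₗ[K] LinearMap.ker p :=
    { toFun := fun v => ⟨((v : N) : B), by
        have hv : pN (v : N) = 0 := LinearMap.mem_ker.mp v.2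
        rw [LinearMap.mem_ker]
        simpa only [hpN, LinearMap.comp_apply, Submodule.subtype_apply] using hv⟩
      map_add' := by intro a b; ext; simp
      map_smul' := by intro c a; ext; simp }
  have hj : Function.Injective j := by
    intro a b hab
    have h := congrArg Subtype.val hab
    apply Subtype.ext; apply Subtype.ext
    exact h
  have h5 : finrank K (LinearMap.ker pN) ≤ finrank K (LinearMap.ker p) :=
    LinearMap.finrank_le_finrank_of_injective hj
  rw [h4] at h3
  omega

/-- REFINED LAST-COLUMN FLOOR (refined Σ-W1 on a block set J): for `π : B → T` with `ker π ≤ im d ⊔ im e` and a surjection `p : B ↠ BJ`,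
`dim BJ ≤ dim T + rank (p ∘ d) + rank (p ∘ e)`. -/
theorem lastColumn_refined_floor (d : A →ₗ[K] B) (e : C →ₗ[K] B) (π : B →ₗ[K] T)
    (hker : LinearMap.ker π ≤ LinearMap.range d ⊔ LinearMap.range e)
    (p : B →ₗ[K] BJ) (hp : Function.Surjective p) :
    finrank K BJ ≤ finrank K T + finrank K (LinearMap.range (p ∘ₗ d)) + finrank K (LinearMap.range (p ∘ₗ e)) := by
  have h1 : finrank K (LinearMap.range π) + finrank K (LinearMap.ker π) = finrank K B :=
    LinearMap.finrank_range_add_finrank_ker π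
  have h2 : finrank K (LinearMap.range π) ≤ finrank K T := Submodule.finrank_le _
  have h3 := finrank_add_finrank_le_of_surjective p hp (LinearMap.ker π)
  -- p(ker π) ≤ p(im d ⊔ im e) = im (p ∘ d) ⊔ im (p ∘ e)
  have h4 : Submodule.map p (LinearMap.ker π) ≤ LinearMap.range (p ∘ₗ d) ⊔ LinearMap.range (p ∘ₗ e) := by
    rw [LinearMap.range_comp, LinearMap.range_comp, ← Submodule.map_sup]
    exact Submodule.map_mono hker
  have h5 : finrank K (Submodule.map p (LinearMap.ker π))
      ≤ finrank K (LinearMap.range (p ∘ₗ d)) + finrank K (LinearMap.range (p ∘ₗ e)) :=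
    (Submodule.finrank_mono h4).trans (finrank_sup_le _ _)
  omega

/-- The case `p ∘ e = 0` (memo §6: `p_J(im d₂) = 0`): `dim BJ ≤ dim T + rank (p ∘ d)`; with `rank (p ∘ d) ≤ adjV¹` this is
`ext² ≥ w¹(J) − adjV¹`. -/
theorem lastColumn_refined_floor_of_comp_eq_zero (d : A →ₗ[K] B) (e : C →ₗ[K] B) (π : B →ₗ[K] T)
    (hker : LinearMap.ker π ≤ LinearMap.range d ⊔ LinearMap.range e)
    (p : B →ₗ[K] BJ) (hp : Function.Surjective p) (hpe : p ∘ₗ e = 0) :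
    finrank K BJ ≤ finrank K T + finrank K (LinearMap.range (p ∘ₗ d)) := by
  have h := lastColumn_refined_floor d e π hker p hp
  have h0 : finrank K (LinearMap.range (p ∘ₗ e)) = 0 := by
    rw [hpe, LinearMap.range_zero]; exact finrank_bot K BJ
  omega

/-- The crude floor is the refined floor with `p = id` (consistency check of the two statements). -/
theorem lastColumn_crude_floor' (d : A →ₗ[K] B) (e : C →ₗ[K] B) (π : B →ₗ[K] T)
    (hker : LinearMap.ker π ≤ LinearMap.range d ⊔ LinearMap.range e) :
    finrank K B ≤ finrank K T + finrank K A + finrank K C := by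
  have h := lastColumn_refined_floor d e π hker LinearMap.id (fun b => ⟨b, rfl⟩)
  have h1 : (LinearMap.id ∘ₗ d : A →ₗ[K] B) = d := LinearMap.id_comp d
  have h2 : (LinearMap.id ∘ₗ e : C →ₗ[K] B) = e := LinearMap.id_comp e
  rw [h1, h2] at h
  have h4 : finrank K (LinearMap.range d) ≤ finrank K A := LinearMap.finrank_range_le d
  have h5 : finrank K (LinearMap.range e) ≤ finrank K C := LinearMap.finrank_range_le e
  omega

end floor

section digits
/-! ## Closed arithmetic of the S6′ digits of record (×2: semihom-2 g4 `u2_sigma_w1.py` and c4-1 g6 `u2x2_s6p.py`, k = 3, NB = 640·k = 1 920, n_c = (1,1)) -/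

/-- w¹(J) = 16·4·2048·4k·NB + 8·5·2048·k·NB = 3 491 758 080; adjV¹ = 8·(2048·(4k)² + 2048·k² + 16·NB²) = 474 365 952; adjU² = 0;
refined Σ-W1(J) = 3 017 392 128 = k²·335 265 792; crude Σ-W1 = e₁^{1,1} − e₁^{0,1} − e₁^{−1,2} = 3 492 581 472 − 474 955 792 − 6 469 632 = 3 011 156 048;
both exceed TARGET = 5 572 = 28 + 448 + 1 960 + 3 136. -/
theorem s6p_sigmaW1_digits :
    (16 * 4 * 2048 * (4 * 3) * 1920 + 8 * 5 * 2048 * 3 * 1920 : ℤ) = 3491758080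
    ∧ (8 * (2048 * (4 * 3) ^ 2 + 2048 * 3 ^ 2 + 16 * 1920 ^ 2) : ℤ) = 474365952
    ∧ (3491758080 : ℤ) - 474365952 - 0 = 3017392128 ∧ (3017392128 : ℤ) = 3 ^ 2 * 335265792
    ∧ (3492581472 : ℤ) - 474955792 - 6469632 = 3011156048
    ∧ (28 + 448 + 1960 + 3136 : ℤ) = 5572 ∧ (5572 : ℤ) < 3011156048 ∧ (3011156048 : ℤ) ≤ 3017392128 := by
  norm_num

/-- The refined digit is bridge-free and closed in (k, NB): with NB = 640·k it is 335 265 792·k², above the door for every k ≥ 1. -/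
theorem deps_sigmaW1_refined_closed_form (k : ℤ) :
    (16 * 4 * 2048 * (4 * k) * (640 * k) + 8 * 5 * 2048 * k * (640 * k)) - 8 * (2048 * (4 * k) ^ 2 + 2048 * k ^ 2 + 16 * (640 * k) ^ 2)
      = 335265792 * k ^ 2 := by
  ring

theorem deps_sigmaW1_refined_beats_door (k : ℤ) (hk : 1 ≤ k) : (5572 : ℤ) < 335265792 * k ^ 2 := by
  nlinarith

/-- Corrected interior cells of the E₁ table (memo §4–§5): the seven differences are the located copy-2 same-copy undercount, and the corrected
EXT²-upper-bound bookkeeping `e₁^{1,1} + e₁^{0,2} + e₁^{−1,3}`. -/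
theorem s6p_E1_corrections :
    (4056316416 : ℤ) - 4052335104 = 3981312 ∧ (31722134040 : ℤ) - 31718152728 = 3981312
    ∧ (22378653040 : ℤ) - 22376496496 = 2156544 ∧ (87177669260 : ℤ) - 87173356172 = 4313088 ∧ (2 * 2156544 : ℤ) = 4313088
    ∧ (3492581472 + 1703632952 + 4056316416 : ℤ) = 9252530840 := by
  norm_num

/-- semihom-2's Σ-F floor on D_ε (SIGMA-F-U2-semihom2-g4 §2; every machine input ×2 in memo §7): κ²(P⁻) = 28 − C(4,2) = 22, κ²(P0) = 28 − C(5,2) = 18,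
floor 22·8 192k + 18·2 048k = 217 088·k > 5 572 for k ≥ 1; unsplit S6′ class digit at k = 3: 22·2048·(4k)² + 18·2048·k² = 6 819 840. -/
theorem deps_sigmaF_digits :
    (28 - Nat.choose 4 2 = 22) ∧ (28 - Nat.choose 5 2 = 18) ∧ (28 - Nat.choose 7 2 = 7)
    ∧ (22 * 8192 + 18 * 2048 : ℤ) = 217088 ∧ (∀ k : ℤ, 1 ≤ k → (5572 : ℤ) < 217088 * k)
    ∧ (22 * 2048 * (4 * 3) ^ 2 + 18 * 2048 * 3 ^ 2 : ℤ) = 6819840 := by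
  refine ⟨by decide, by decide, by decide, by norm_num, fun k hk => by omega, by norm_num⟩

/-- LOEWNER scan bookkeeping (memo §0): 2 358 656 H₀-orbit representatives × |H₀| = 16 = 37 738 496 ordered configuration pairs; 36 family pairs of
64 × 1024 representatives minus the excluded identical-configuration diagonals account for the count. -/
theorem loewner_scan_count : (16 * 2358656 : ℤ) = 37738496 ∧ (36 * (64 * 1024) : ℤ) - 2358656 = 640 := by
  norm_num

end digits

end Summit.HodgeConjecture.HodgeConjecture.Cruxes.BlochSeedDiscOne.SigmaW1Row
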